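import Summits.NavierStokesRegularity.FluidComputer.PalasekTowerStageTightness
import Summits.NavierStokesRegularity.FluidComputer.PalasekTowerRegisterGlobalEnvelopeAt
import Summits.NavierStokesRegularity.FluidComputer.PalasekTowerRegisterGlobalCeiling

/-!
# REGISTER v2.3′: an OVERSHOOT of the next ceiling, if it happens, first happens at a pressure-driven
# global argmax at a silent time — the upper-half stub `AprioriCeilingAt k` as a sign condition on `⟪u, ∇p⟫`

Cell `ns-blowup`, seat `ns-blowup-fc-prover-3` (g2; prover; D-0074 GROUP C/E «BRIDGE SUPPORT»;
bears_on LADDER-NS N1, route `PalasekTowerBreakdown`, child crux items stmt-NavierStokesRegularity-19249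
`HeredityAtOne` (stub `ContinuationEnvelopeAt 1 = LocalContinuationAt 1 ∧ AprioriCeilingAt 1`) and
19250 `HeredityFromTwo` (upper half `AprioriCeiling`) — supports only, nothing claimed or closed). The
DUAL of `PalasekTowerStageTightness.lean` (this seat, p441519: every floor speed is first reached at a
pressure-driven argmax): here the level is the next CEILING `c₂ Y_{k+1}` and the flow is any
finite-energy classical CONTINUATION of a registered stage — the object the stub `AprioriCeilingAt k`
quantifies over. LABEL: E–C typing (KERNEL analysis; every statement PROVED; no `Prop` introduced; no
unproved fact). WHAT THIS IS NOT: not Navier–Stokes evidence — nothing is constructed; the stub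
`AprioriCeilingAt k` is neither proved nor refuted; the theorems say HOW it can fail.

## What is proved

* §1 the hitting calculus for a general classical solution on a closed slab `[0, T]` (the `Stage`
  versions are in `PalasekTowerWindowFirstHitting.lean`): at a hitting point (global spatial argmax at
  `t₀ ∈ (0, T]`, never exceeded at `x₀` before) `ν|Du|²_F + ⟪u, ∇p⟫ ≤ ⟪u, f⟫`
  (`HittingCalculus.hitting_inequality`); the first hitting of a level reached on the slab exists once
  the super-level set of the slab is bounded (`HittingCalculus.exists_firstHitting_of_decay`).
* §2 `exists_firstHitting_of_clayContinuation` — for ANY finite-energy classical solution on `[0, T]`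
  with Schwartz datum and Clay force (`ν > 0`) and any level `L` not reached on `[0, T₁]` but reached
  later: a first-hitting point exists, UNCONDITIONALLY (Tao class ⇒ bounded speed and gradient ⇒
  uniform decay by `LocalEnergy.exists_radius_norm_lt` ⇒ §1), with the hitting inequality.
* §3 `Stage.exists_firstOvershoot` — for a stage at level `k ≥ 1` of a QUIET schedule and a
  finite-energy classical continuation `(u, p)` of it to `[0, T']`, `T' ≥ τ_k`, that reaches a level
  `L > c₂ Y_k` somewhere: the level is first reached at `t⋆ ∈ (τ_k, T']`, at a global argmax `x⋆`,
  force-free, with `ν|Du(t⋆, x⋆)|² + ⟪u, ∇p⟫(t⋆, x⋆) ≤ 0`.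
* §4 `aprioriCeilingAt_of_noPush` — **a sufficient condition for the upper-half stub**: if for every
  pinned rigid quiet wide schedule, every registered level-`k` stage (`k ≥ 1`) and every finite-energy
  classical continuation on `[0, T'] ⊆ [0, τ_{k+1}]`, at every point `(t, x)` with `τ_k < t` where the
  speed equals `c₂ Y_{k+1}`, is globally maximal and was smaller at all earlier times, the pressure does
  NOT push hard enough — `0 < ν|Du(t, x)|² + ⟪u, ∇p⟫(t, x)` — then `AprioriCeilingAt k` holds. So the
  physics bet «no overshoot» is EXACTLY a sign condition on `⟪u, ∇p⟫ + ν|Du|²` at first touchings of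
  the sphere `‖u‖ = c₂ Y_{k+1}` by speed maxima, for continuations of registered stages.

References: S. Palasek, arXiv:2605.13827 §4 [cite: Palasek2026ElementaryModel, §4]; D. Gilbarg,
N. Trudinger, *Elliptic PDE*, §3.1 [cite: GilbargTrudinger2001, §3.1]; T. Tao, Anal. PDE 6 (2013),
Cor. 11.1 [cite: Tao2011, Cor. 11.1].
-/

noncomputable section

namespace Summit.NavierStokesRegularity.FluidComputer.PalasekTowerClayBridge

open Set MeasureTheory Filter Topology Function Real
open scoped ENNReal ContDiff NNReal InnerProductSpace RealInnerProductSpace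
open Laplacian
open Literature.Analysis.FluidPDE

/-! ## §1 The hitting calculus for a classical solution on a closed slab -/

namespace HittingCalculus

variable {ν T : ℝ} {f u : ℝ → EuclideanSpace ℝ (Fin 3) → EuclideanSpace ℝ (Fin 3)}
  {p : ℝ → EuclideanSpace ℝ (Fin 3) → ℝ}

/-- Spatial first-order condition at a speed maximum of a classical slice: `⟪u, Du·v⟫ = 0`.
[folklore] -/
theorem inner_fderiv_eq_zero_of_isMax (h : IsClassicalNSSolutionOn (Icc 0 T) ν f u p) {t₀ : ℝ}
    (ht₀ : t₀ ∈ Icc 0 T) {x₀ : EuclideanSpace ℝ (Fin 3)} (hmax : ∀ x, ‖u t₀ x‖ ≤ ‖u t₀ x₀‖)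
    (v : EuclideanSpace ℝ (Fin 3)) : ⟪u t₀ x₀, fderiv ℝ (u t₀) x₀ v⟫ = 0 := by
  set U := u t₀ with hU
  have hC1 : ContDiff ℝ 1 U := (h.contDiff_velocity ht₀).of_le (by norm_cast)
  have hd : HasFDerivAt U (fderiv ℝ U x₀) x₀ := (hC1.differentiable one_ne_zero x₀).hasFDerivAt
  have hloc : IsLocalMax (fun x => ‖U x‖ ^ 2) x₀ :=
    Filter.Eventually.of_forall fun x => pow_le_pow_left₀ (norm_nonneg _) (hmax x) 2
  have h0 := hloc.hasFDerivAt_eq_zero hd.norm_sq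
  rw [two_nsmul] at h0
  have h2 := congrArg (fun L : EuclideanSpace ℝ (Fin 3) →L[ℝ] ℝ => L v) h0
  simp only [add_apply, ContinuousLinearMap.comp_apply, innerSL_apply_apply, zero_apply] at h2
  linarith

/-- Temporal first-order condition at a hitting point: `0 ≤ ⟪u, ∂ₜu⟫` within the slab. [folklore] -/
theorem inner_timeDeriv_nonneg_of_past (h : IsClassicalNSSolutionOn (Icc 0 T) ν f u p) {t₀ : ℝ}
    (ht₀ : t₀ ∈ Ioc 0 T) {x₀ : EuclideanSpace ℝ (Fin 3)}
    (hpast : ∀ t ∈ Ico 0 t₀, ‖u t x₀‖ ≤ ‖u t₀ x₀‖) :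
    0 ≤ ⟪u t₀ x₀, timeDerivWithin (Icc 0 T) u t₀ x₀⟫ := by
  have ht₀' : t₀ ∈ Icc 0 T := ⟨ht₀.1.le, ht₀.2⟩
  set D := timeDerivWithin (Icc 0 T) u t₀ x₀ with hD
  have hline : HasDerivWithinAt (fun t => u t x₀) D (Icc 0 T) t₀ := by
    have h1 := (h.smooth_velocity.differentiableWithinAt_time ht₀' x₀).hasDerivWithinAt
    simpa only [hD, timeDerivWithin_apply] using h1
  have hsq : HasDerivWithinAt (fun t => ‖u t x₀‖ ^ 2) (2 * ⟪u t₀ x₀, D⟫) (Icc 0 t₀) t₀ :=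
    hline.norm_sq.mono (Icc_subset_Icc_right ht₀.2)
  have hmax : IsLocalMaxOn (fun t => ‖u t x₀‖ ^ 2) (Icc 0 t₀) t₀ := by
    refine eventually_nhdsWithin_of_forall fun t ht => ?_
    show ‖u t x₀‖ ^ 2 ≤ ‖u t₀ x₀‖ ^ 2
    rcases ht.2.eq_or_lt with h' | h'
    · rw [h']
    · exact pow_le_pow_left₀ (norm_nonneg _) (hpast t ⟨ht.1, h'⟩) 2
  have hy : (0 : ℝ) - t₀ ∈ posTangentConeAt (Icc 0 t₀) t₀ := by
    apply sub_mem_posTangentConeAt_of_segment_subset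
    rw [segment_symm, segment_eq_Icc ht₀.1.le]
  have hle := hmax.hasFDerivWithinAt_nonpos hsq.hasFDerivWithinAt hy
  simp only [ContinuousLinearMap.toSpanSingleton_apply, smul_eq_mul] at hle
  by_contra hneg
  have hneg' : ⟪u t₀ x₀, D⟫ < 0 := lt_of_not_ge hneg
  have h0 : 0 < t₀ := ht₀.1
  have : 0 < (0 - t₀) * (2 * ⟪u t₀ x₀, D⟫) := mul_pos_of_neg_of_neg (by linarith) (by linarith)
  linarith

/-- **The hitting inequality for a classical solution**: at a hitting point (`t₀ ∈ (0, T]`, global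
spatial argmax, never exceeded at `x₀` before), `ν|Du|²_F + ⟪u, ∇p⟫ ≤ ⟪u, f⟫` (`ν ≥ 0`).
[cite: GilbargTrudinger2001, §3.1] -/
theorem hitting_inequality (h : IsClassicalNSSolutionOn (Icc 0 T) ν f u p) (hν : 0 ≤ ν) {t₀ : ℝ}
    (ht₀ : t₀ ∈ Ioc 0 T) {x₀ : EuclideanSpace ℝ (Fin 3)} (hmax : ∀ x, ‖u t₀ x‖ ≤ ‖u t₀ x₀‖)
    (hpast : ∀ t ∈ Ico 0 t₀, ‖u t x₀‖ ≤ ‖u t₀ x₀‖) :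
    ν * frobeniusNormSq (fderiv ℝ (u t₀) x₀) + ⟪u t₀ x₀, gradient (p t₀) x₀⟫ ≤ ⟪u t₀ x₀, f t₀ x₀⟫ := by
  have ht₀' : t₀ ∈ Icc 0 T := ⟨ht₀.1.le, ht₀.2⟩
  -- momentum at the point, with `⟪u, ∂ₜu⟫ ≥ 0` and `⟪u, (u·∇)u⟫ = 0`
  have hmom := h.momentum t₀ ht₀' x₀
  have hD : timeDerivWithin (Icc 0 T) u t₀ x₀ =
      ν • Δ (u t₀) x₀ - gradient (p t₀) x₀ + f t₀ x₀ - convect (u t₀) (u t₀) x₀ := by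
    rw [← hmom]; abel
  have h1 := inner_timeDeriv_nonneg_of_past h ht₀ hpast
  have hconv : ⟪u t₀ x₀, convect (u t₀) (u t₀) x₀⟫ = 0 := by
    rw [convect_apply]; exact inner_fderiv_eq_zero_of_isMax h ht₀' hmax _
  rw [hD, inner_sub_right, inner_add_right, inner_sub_right, real_inner_smul_right, hconv] at h1
  -- second-order condition
  set U := u t₀ with hU
  have hC2 : ContDiff ℝ 2 U := (h.contDiff_velocity ht₀').of_le (by norm_cast)
  have hloc : IsLocalMax (fun x => ⟪U x, U x⟫) x₀ := by
    have h' : IsLocalMax (fun x => ‖U x‖ ^ 2) x₀ :=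
      Filter.Eventually.of_forall fun x => pow_le_pow_left₀ (norm_nonneg _) (hmax x) 2
    simpa only [real_inner_self_eq_norm_sq] using h'
  have hΔ : (Δ fun y => ⟪U y, U y⟫) x₀ ≤ 0 := laplacian_nonpos_of_isLocalMax (hC2.inner ℝ hC2) hloc
  rw [laplacian_inner_self_eq hC2 x₀, real_inner_comm] at hΔ
  have h3 : ν * ⟪U x₀, Δ U x₀⟫ ≤ ν * (- frobeniusNormSq (fderiv ℝ U x₀)) :=
    mul_le_mul_of_nonneg_left (by linarith) hν
  linarith

/-- Left-continuity of time lines: a bound valid on `[0, t₀)` persists at `t₀ ∈ (0, T]`. [folklore] -/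
theorem norm_le_of_forall_lt (h : IsClassicalNSSolutionOn (Icc 0 T) ν f u p) {t₀ : ℝ}
    (ht₀ : t₀ ∈ Ioc 0 T) (x : EuclideanSpace ℝ (Fin 3)) {L : ℝ} (hL : ∀ t ∈ Ico 0 t₀, ‖u t x‖ ≤ L) :
    ‖u t₀ x‖ ≤ L := by
  have ht₀' : t₀ ∈ Icc 0 T := ⟨ht₀.1.le, ht₀.2⟩
  have hcont : ContinuousWithinAt (fun t => ‖u t x‖) (Ico 0 t₀) t₀ :=
    ((h.smooth_velocity.differentiableWithinAt_time ht₀' x).continuousWithinAt.norm).mono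
      fun t ht => ⟨ht.1, ht.2.le.trans ht₀.2⟩
  haveI hne : (𝓝[Ico 0 t₀] t₀).NeBot := by
    refine mem_closure_iff_nhdsWithin_neBot.1 ?_
    rw [closure_Ico ht₀.1.ne]
    exact right_mem_Icc.2 ht₀.1.le
  exact le_of_tendsto hcont (eventually_nhdsWithin_of_forall hL)

/-- **First hitting of a level on a closed slab, given a bounded super-level set.** [folklore] -/
theorem exists_firstHitting_of_decay (h : IsClassicalNSSolutionOn (Icc 0 T) ν f u p) {L T₁ T₂ : ℝ}
    (hT₁ : T₁ ∈ Icc 0 T) (hT₁₂ : T₁ ≤ T₂) (hT₂ : T₂ ≤ T)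
    (hbefore : ∀ t ∈ Icc 0 T₁, ∀ x, ‖u t x‖ < L) (hreach : ∃ x, L ≤ ‖u T₂ x‖)
    (hdec : ∃ ρ : ℝ, ∀ t ∈ Icc 0 T, ∀ x : EuclideanSpace ℝ (Fin 3), ρ ≤ ‖x‖ → ‖u t x‖ < L) :
    ∃ t₀ ∈ Ioc T₁ T₂, ∃ x₀ : EuclideanSpace ℝ (Fin 3),
      ‖u t₀ x₀‖ = L ∧ (∀ x, ‖u t₀ x‖ ≤ L) ∧ (∀ t ∈ Ico 0 t₀, ∀ x, ‖u t x‖ < L) := by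
  obtain ⟨ρ, hρ⟩ := hdec
  set Dm : Set (ℝ × EuclideanSpace ℝ (Fin 3)) :=
    Icc (0 : ℝ) T ×ˢ Metric.closedBall (0 : EuclideanSpace ℝ (Fin 3)) ρ with hDdef
  have hDc : IsCompact Dm := isCompact_Icc.prod (isCompact_closedBall _ _)
  have hDcl : IsClosed Dm := isClosed_Icc.prod Metric.isClosed_closedBall
  have hcont : ContinuousOn (fun z : ℝ × EuclideanSpace ℝ (Fin 3) => ‖uncurry u z‖) Dm :=
    (h.smooth_velocity.continuousOn.mono (prod_mono le_rfl (subset_univ _))).norm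
  set K : Set (ℝ × EuclideanSpace ℝ (Fin 3)) :=
    Dm ∩ (fun z : ℝ × EuclideanSpace ℝ (Fin 3) => ‖uncurry u z‖) ⁻¹' Ici L with hKdef
  have hKcl : IsClosed K := hcont.preimage_isClosed_of_isClosed hDcl isClosed_Ici
  have hKc : IsCompact K := hDc.of_isClosed_subset hKcl inter_subset_left
  set A : Set ℝ := Prod.fst '' K with hAdef
  have hAcl : IsClosed A := (hKc.image continuous_fst).isClosed
  have hAbdd : BddBelow A := ⟨0, fun t ht => by
    obtain ⟨z, hz, rfl⟩ := ht
    exact hz.1.1.1⟩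
  have hmemK : ∀ t ∈ Icc 0 T, ∀ x, L ≤ ‖u t x‖ → (t, x) ∈ K := by
    intro t ht x hx
    have hxρ : ‖x‖ ≤ ρ := by
      by_contra hlt
      exact absurd hx (not_le.2 (hρ t ht x (le_of_not_ge hlt)))
    refine ⟨⟨ht, ?_⟩, ?_⟩
    · rwa [Metric.mem_closedBall, dist_zero_right]
    · simpa using hx
  have hT₂0 : 0 ≤ T₂ := hT₁.1.trans hT₁₂
  have hT₂A : T₂ ∈ A := by
    obtain ⟨x, hx⟩ := hreach
    exact ⟨(T₂, x), hmemK T₂ ⟨hT₂0, hT₂⟩ x hx, rfl⟩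
  have ht₀A : sInf A ∈ A := hAcl.csInf_mem ⟨T₂, hT₂A⟩ hAbdd
  obtain ⟨⟨t', x₀⟩, hzK, hzt⟩ := ht₀A
  simp only at hzt
  have ht₀slab : t' ∈ Icc 0 T := hzK.1.1
  have hx₀ : L ≤ ‖u t' x₀‖ := by simpa using hzK.2
  have ht₀T₂ : t' ≤ T₂ := by rw [hzt]; exact csInf_le hAbdd hT₂A
  have hT₁t₀ : T₁ < t' := by
    by_contra hle
    exact absurd hx₀ (not_le.2 (hbefore t' ⟨ht₀slab.1, le_of_not_gt hle⟩ x₀))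
  have ht₀pos : 0 < t' := lt_of_le_of_lt hT₁.1 hT₁t₀
  have hstrict : ∀ t ∈ Ico 0 t', ∀ x, ‖u t x‖ < L := by
    intro t ht x
    by_contra hge
    have htA : t ∈ A := ⟨(t, x), hmemK t ⟨ht.1, ht.2.le.trans ht₀slab.2⟩ x (le_of_not_gt hge), rfl⟩
    have h1 : sInf A ≤ t := csInf_le hAbdd htA
    rw [← hzt] at h1
    exact absurd h1 (not_le.2 ht.2)
  have hle : ∀ x, ‖u t' x‖ ≤ L := fun x =>
    norm_le_of_forall_lt h ⟨ht₀pos, ht₀slab.2⟩ x fun t ht => (hstrict t ht x).le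
  exact ⟨t', ⟨hT₁t₀, ht₀T₂⟩, x₀, le_antisymm (hle x₀) hx₀, hle, hstrict⟩

end HittingCalculus

/-! ## §2 Any finite-energy classical Clay solution: first hitting of a level, unconditionally -/

/-- **First hitting of a speed level for ANY finite-energy classical solution with Schwartz datum and
Clay force** (`ν > 0`): if `‖u‖ < L` on `[0, T₁] × ℝ³` and `L ≤ ‖u(T₂, x)‖` for some `x` and
`T₁ ≤ T₂ ≤ T`, there are `t⋆ ∈ (T₁, T₂]` and a global argmax `x⋆` with `‖u(t⋆, x⋆)‖ = L`, `‖u‖ < L`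
on `[0, t⋆) × ℝ³`, `0 ≤ ⟪u, ∂ₜu⟫`, and `ν|Du|²_F + ⟪u, ∇p⟫ ≤ ⟪u, f⟫` at `(t⋆, x⋆)`. Unconditional:
the solution is in Tao's class (lit g10), so its speed and gradient are bounded on the slab and its
super-level sets are bounded uniformly in time (`LocalEnergy.exists_radius_norm_lt`).
[cite: Tao2011, Cor. 11.1] [cite: GilbargTrudinger2001, §3.1] -/
theorem exists_firstHitting_of_clayContinuation {ν T : ℝ} (hν : 0 < ν) (hT : 0 < T)
    {f u : ℝ → EuclideanSpace ℝ (Fin 3) → EuclideanSpace ℝ (Fin 3)}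
    {p : ℝ → EuclideanSpace ℝ (Fin 3) → ℝ}
    (h : IsClassicalNSSolutionOn (Icc 0 T) ν f u p) (h₀ : HasRapidSpatialDecay (u 0))
    (hfs : IsSmoothOnHalfSpace f) (hfd : HasRapidSpaceTimeDecay f)
    (hE : ∃ C : ℝ≥0∞, C < ⊤ ∧ ∀ t ∈ Icc 0 T, ∫⁻ x, ‖u t x‖ₑ ^ 2 ≤ C)
    {L T₁ T₂ : ℝ} (hL : 0 < L) (hT₁ : T₁ ∈ Icc 0 T) (hT₁₂ : T₁ ≤ T₂) (hT₂ : T₂ ≤ T)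
    (hbefore : ∀ t ∈ Icc 0 T₁, ∀ x, ‖u t x‖ < L) (hreach : ∃ x, L ≤ ‖u T₂ x‖) :
    ∃ t₀ ∈ Ioc T₁ T₂, ∃ x₀ : EuclideanSpace ℝ (Fin 3),
      ‖u t₀ x₀‖ = L ∧ (∀ x, ‖u t₀ x‖ ≤ L) ∧ (∀ t ∈ Ico 0 t₀, ∀ x, ‖u t x‖ < L) ∧
      0 ≤ ⟪u t₀ x₀, timeDerivWithin (Icc 0 T) u t₀ x₀⟫ ∧
      ν * frobeniusNormSq (fderiv ℝ (u t₀) x₀) + ⟪u t₀ x₀, gradient (p t₀) x₀⟫ ≤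
        ⟪u t₀ x₀, f t₀ x₀⟫ := by
  -- Tao's class: bounded speed and gradient on the slab
  obtain ⟨C, hCt, hC⟩ := hE
  have hE' : ∃ C : ℝ≥0, ∀ t ∈ Icc 0 T, ∫⁻ x, ‖u t x‖ₑ ^ 2 ≤ C :=
    ⟨C.toNNReal, fun t ht => (hC t ht).trans (ENNReal.coe_toNNReal hCt.ne).ge⟩
  have hTao : HasBoundedSobolevNormsOn (Icc 0 T) u :=
    h.hasBoundedSobolevNormsOn_of_clayForce hν hT hE' h₀ hfs hfd
  have hsm : ∀ t ∈ Icc 0 T, ContDiff ℝ ∞ (u t) := fun t ht => h.contDiff_velocity ht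
  obtain ⟨M, -, hM⟩ := hTao.exists_forall_norm_iteratedFDeriv_le hsm 0
  obtain ⟨B, -, hB⟩ := hTao.exists_forall_norm_iteratedFDeriv_le hsm 1
  have hM' : ∀ t ∈ Icc 0 T, ∀ x, ‖u t x‖ ≤ M := fun t ht x => by simpa using hM t ht x
  have hB' : ∀ t ∈ Icc 0 T, ∀ x, ‖fderiv ℝ (u t) x‖ ≤ B := fun t ht x => by
    have h1 := hB t ht x
    rwa [← norm_iteratedFDeriv_fderiv (n := 0), norm_iteratedFDeriv_zero] at h1
  -- uniform decay, first hitting, hitting inequality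
  have hdec := LocalEnergy.exists_radius_norm_lt hν hT h hfs hfd hM' hB' hE' hL
  obtain ⟨t₀, ht₀, x₀, heq, hle, hstrict⟩ :=
    HittingCalculus.exists_firstHitting_of_decay h hT₁ hT₁₂ hT₂ hbefore hreach hdec
  have ht₀' : t₀ ∈ Ioc 0 T := ⟨lt_of_le_of_lt hT₁.1 ht₀.1, ht₀.2.trans hT₂⟩
  have hmax : ∀ x, ‖u t₀ x‖ ≤ ‖u t₀ x₀‖ := fun x => (hle x).trans heq.ge
  have hpast : ∀ t ∈ Ico 0 t₀, ‖u t x₀‖ ≤ ‖u t₀ x₀‖ := fun t ht => (hstrict t ht x₀).le.trans heq.ge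
  exact ⟨t₀, ht₀, x₀, heq, hle, hstrict, HittingCalculus.inner_timeDeriv_nonneg_of_past h ht₀' hpast,
    HittingCalculus.hitting_inequality h hν.le ht₀' hmax hpast⟩

/-! ## §3 Continuations of registered stages: the first overshoot is pressure-driven and force-free -/

namespace Stage

variable {ν : ℝ} {R : TowerRates} {S : Schedule R} {m : Margins R} {k : ℕ}

/-- **The first overshoot of a continuation of a registered stage.** Let `s` be a stage at level
`k ≥ 1` of a QUIET schedule (`ν > 0`), `(u, p)` a classical continuation of it to `[0, T']`, `T' ≥ τ_k`
(design force `S.f`, velocity agreeing with `s` on `[0, τ_k]`, finite energy), and `L > c₂ Y_k` a level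
reached by `u` at some time of the slab. Then `L` is reached for the FIRST time at some
`t⋆ ∈ (τ_k, T']`, at a global argmax `x⋆`, where the force is silent and
`ν|Du(t⋆, x⋆)|²_F + ⟪u, ∇p⟫(t⋆, x⋆) ≤ 0` — an overshoot is PRESSURE-DRIVEN at its first instant.
[cite: Palasek2026ElementaryModel, §4] -/
theorem exists_firstOvershoot (hν : 0 < ν) (hQ : S.Quiet) (hk : 1 ≤ k) (s : Stage ν R S m k)
    {T' : ℝ} (hT' : S.τ k ≤ T')
    {u : ℝ → EuclideanSpace ℝ (Fin 3) → EuclideanSpace ℝ (Fin 3)}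
    {p : ℝ → EuclideanSpace ℝ (Fin 3) → ℝ}
    (hcl : IsClassicalNSSolutionOn (Icc 0 T') ν S.f u p)
    (hagree : ∀ t ∈ Icc 0 (S.τ k), u t = s.u t)
    (henergy : ∃ C : ℝ≥0∞, C < ⊤ ∧ ∀ t ∈ Icc 0 T', ∫⁻ x, ‖u t x‖ₑ ^ 2 ≤ C)
    {L : ℝ} (hL : S.c₂ * R.Y k < L) (hreach : ∃ t ∈ Icc 0 T', ∃ x, L ≤ ‖u t x‖) :
    ∃ t₀ ∈ Ioc (S.τ k) T', ∃ x₀ : EuclideanSpace ℝ (Fin 3),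
      ‖u t₀ x₀‖ = L ∧ (∀ x, ‖u t₀ x‖ ≤ L) ∧ (∀ t ∈ Ico 0 t₀, ∀ x, ‖u t x‖ < L) ∧
      0 ≤ ⟪u t₀ x₀, timeDerivWithin (Icc 0 T') u t₀ x₀⟫ ∧
      ν * frobeniusNormSq (fderiv ℝ (u t₀) x₀) + ⟪u t₀ x₀, gradient (p t₀) x₀⟫ ≤ 0 := by
  obtain ⟨T₂, hT₂, x₂, hx₂⟩ := hreach
  have hT'0 : 0 < T' := (S.τ_pos k).trans_le hT'
  have h₀ : HasRapidSpatialDecay (u 0) := by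
    rw [hagree 0 ⟨le_rfl, (S.τ_pos k).le⟩]
    exact s.hasRapidSpatialDecay_zero
  have hL0 : 0 < L := lt_trans (mul_pos s.c₂_pos (Real.rpow_pos_of_pos (R.N_pos k) _)) hL
  -- below the level on `[0, τ_k]` (ceiling of the stage), so the level is reached after `τ_k`
  have hbefore : ∀ t ∈ Icc 0 (S.τ k), ∀ x, ‖u t x‖ < L := fun t ht x => by
    rw [hagree t ht]; exact lt_of_le_of_lt (s.ceiling k le_rfl t ht x) hL
  have hτT₂ : S.τ k ≤ T₂ := by
    by_contra hlt
    exact absurd hx₂ (not_le.2 (hbefore T₂ ⟨hT₂.1, le_of_not_ge hlt⟩ x₂))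
  obtain ⟨t₀, ht₀, x₀, heq, hle, hstrict, htime, hineq⟩ :=
    exists_firstHitting_of_clayContinuation hν hT'0 hcl h₀ S.force_smooth S.force_decay henergy hL0
      ⟨(S.τ_pos k).le, hT'⟩ hτT₂ hT₂.2 hbefore ⟨x₂, hx₂⟩
  refine ⟨t₀, ⟨ht₀.1, ht₀.2.trans hT₂.2⟩, x₀, heq, hle, hstrict, htime, ?_⟩
  have h1 : S.τ 1 ≤ t₀ := (S.τ_mono hk).trans ht₀.1.le
  rwa [hQ.apply h1 x₀, inner_zero_right] at hineq

/-- **The first overshoot of the NEXT CEILING** (`L = c₂ Y_{k+1}`): if a finite-energy classical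
continuation of a registered stage at level `k ≥ 1` of a quiet schedule EXCEEDS (or touches) the next
ceiling `c₂ Y_{k+1}` somewhere on `[0, T']`, it first touches it at `t⋆ ∈ (τ_k, T']`, at a global argmax,
with `ν|Du|²_F + ⟪u, ∇p⟫ ≤ 0` there (`c₂ Y_k < c₂ Y_{k+1}` by `TowerRates.Y_lt_Y_succ`). This is HOW
the stub `AprioriCeilingAt k` can fail. [cite: Palasek2026ElementaryModel, §4] -/
theorem exists_firstOvershoot_ceiling (hν : 0 < ν) (hQ : S.Quiet) (hk : 1 ≤ k) (s : Stage ν R S m k)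
    {T' : ℝ} (hT' : S.τ k ≤ T')
    {u : ℝ → EuclideanSpace ℝ (Fin 3) → EuclideanSpace ℝ (Fin 3)}
    {p : ℝ → EuclideanSpace ℝ (Fin 3) → ℝ}
    (hcl : IsClassicalNSSolutionOn (Icc 0 T') ν S.f u p)
    (hagree : ∀ t ∈ Icc 0 (S.τ k), u t = s.u t)
    (henergy : ∃ C : ℝ≥0∞, C < ⊤ ∧ ∀ t ∈ Icc 0 T', ∫⁻ x, ‖u t x‖ₑ ^ 2 ≤ C)
    (hreach : ∃ t ∈ Icc 0 T', ∃ x, S.c₂ * R.Y (k + 1) ≤ ‖u t x‖) :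
    ∃ t₀ ∈ Ioc (S.τ k) T', ∃ x₀ : EuclideanSpace ℝ (Fin 3),
      ‖u t₀ x₀‖ = S.c₂ * R.Y (k + 1) ∧ (∀ x, ‖u t₀ x‖ ≤ S.c₂ * R.Y (k + 1)) ∧
      (∀ t ∈ Ico 0 t₀, ∀ x, ‖u t x‖ < S.c₂ * R.Y (k + 1)) ∧
      0 ≤ ⟪u t₀ x₀, timeDerivWithin (Icc 0 T') u t₀ x₀⟫ ∧
      ν * frobeniusNormSq (fderiv ℝ (u t₀) x₀) + ⟪u t₀ x₀, gradient (p t₀) x₀⟫ ≤ 0 :=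
  s.exists_firstOvershoot hν hQ hk hT' hcl hagree henergy
    (mul_lt_mul_of_pos_left (R.Y_lt_Y_succ k) s.c₂_pos) hreach

end Stage

/-! ## §4 The upper-half stub as a sign condition on the pressure at first touchings -/

/-- **`AprioriCeilingAt k` from a pointwise PRESSURE CONDITION** (`k ≥ 1`): if for every pinned rigid
quiet wide schedule, every registered level-`k` stage, every `T' ∈ [τ_k, τ_{k+1}]` and every
finite-energy classical continuation `(u, p)` on `[0, T']`, at every point `(t, x)` with `τ_k < t ≤ T'`
where the speed EQUALS the next ceiling `c₂ Y_{k+1}`, is globally maximal, and was `< c₂ Y_{k+1}` at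
all earlier times everywhere, one has `0 < |Du(t, x)|²_F + ⟪u, ∇p⟫(t, x)` (unit viscosity) — «the
pressure never pushes a first touching of the ceiling» — then the a-priori ceiling holds. Contrapositive
of `Stage.exists_firstOvershoot_ceiling`. [cite: Palasek2026ElementaryModel, §4] -/
theorem aprioriCeilingAt_of_noPush {k : ℕ} (hk : 1 ≤ k)
    (h : ∀ S : Schedule TowerRates.wide, S.Pins 8 (6 / 5) → S.Rigid → S.Quiet →
      ∀ s : Stage 1 TowerRates.wide S (Margins.routeG TowerRates.wide) k,
      ∀ T' ∈ Icc (S.τ k) (S.τ (k + 1)),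
      ∀ (u : ℝ → EuclideanSpace ℝ (Fin 3) → EuclideanSpace ℝ (Fin 3))
        (p : ℝ → EuclideanSpace ℝ (Fin 3) → ℝ),
        IsClassicalNSSolutionOn (Icc 0 T') 1 S.f u p →
        (∀ t ∈ Icc 0 (S.τ k), u t = s.u t ∧ p t = s.p t) →
        (∃ C : ℝ≥0∞, C < ⊤ ∧ ∀ t ∈ Icc 0 T', ∫⁻ x, ‖u t x‖ₑ ^ 2 ≤ C) →
        ∀ t ∈ Ioc (S.τ k) T', ∀ x : EuclideanSpace ℝ (Fin 3),
          ‖u t x‖ = S.c₂ * TowerRates.wide.Y (k + 1) →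
          (∀ y, ‖u t y‖ ≤ S.c₂ * TowerRates.wide.Y (k + 1)) →
          (∀ t' ∈ Ico 0 t, ∀ y, ‖u t' y‖ < S.c₂ * TowerRates.wide.Y (k + 1)) →
          0 < frobeniusNormSq (fderiv ℝ (u t) x) + ⟪u t x, gradient (p t) x⟫) :
    AprioriCeilingAt k := by
  intro S hP hR hQ s T' hT' u p hcl hagree henergy t ht x
  by_contra hgt
  have hgt' : S.c₂ * TowerRates.wide.Y (k + 1) ≤ ‖u t x‖ := le_of_not_ge hgt
  obtain ⟨t₀, ht₀, x₀, heq, hle, hstrict, -, hineq⟩ :=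
    s.exists_firstOvershoot_ceiling one_pos hQ hk hT'.1 hcl (fun t ht => (hagree t ht).1) henergy
      ⟨t, ht, x, hgt'⟩
  have hpos := h S hP hR hQ s T' hT' u p hcl hagree henergy t₀ ht₀ x₀ heq hle hstrict
  rw [one_mul] at hineq
  exact absurd hineq (not_le.2 hpos)

/-- **`AprioriCeiling` (upper half of `HeredityFromTwo`, all `k ≥ 2`) from the pressure sign condition at
every level**: no pressure-push (`0 < |Du|²_F + ⟪u, ∇p⟫`) at any first touching of the next ceiling
`c₂ Y_{k+1}` by a global speed maximum of a finite-energy classical continuation of a registered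
level-`k` stage, `k ≥ 2`, implies `AprioriCeiling`; with `ReadoutFloors` this gives `HeredityFrom 2`
(`heredityFrom_two_of_aprioriCeiling_floors`). [cite: Palasek2026ElementaryModel, §4] -/
theorem aprioriCeiling_of_noPush
    (h : ∀ S : Schedule TowerRates.wide, S.Pins 8 (6 / 5) → S.Rigid → S.Quiet → ∀ k : ℕ, 2 ≤ k →
      ∀ s : Stage 1 TowerRates.wide S (Margins.routeG TowerRates.wide) k,
      ∀ T' ∈ Icc (S.τ k) (S.τ (k + 1)),
      ∀ (u : ℝ → EuclideanSpace ℝ (Fin 3) → EuclideanSpace ℝ (Fin 3))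
        (p : ℝ → EuclideanSpace ℝ (Fin 3) → ℝ),
        IsClassicalNSSolutionOn (Icc 0 T') 1 S.f u p →
        (∀ t ∈ Icc 0 (S.τ k), u t = s.u t ∧ p t = s.p t) →
        (∃ C : ℝ≥0∞, C < ⊤ ∧ ∀ t ∈ Icc 0 T', ∫⁻ x, ‖u t x‖ₑ ^ 2 ≤ C) →
        ∀ t ∈ Ioc (S.τ k) T', ∀ x : EuclideanSpace ℝ (Fin 3),
          ‖u t x‖ = S.c₂ * TowerRates.wide.Y (k + 1) →
          (∀ y, ‖u t y‖ ≤ S.c₂ * TowerRates.wide.Y (k + 1)) →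
          (∀ t' ∈ Ico 0 t, ∀ y, ‖u t' y‖ < S.c₂ * TowerRates.wide.Y (k + 1)) →
          0 < frobeniusNormSq (fderiv ℝ (u t) x) + ⟪u t x, gradient (p t) x⟫) :
    AprioriCeiling := by
  intro S hP hR hQ k hk s T' hT' u p hcl hagree henergy t ht x
  by_contra hgt
  obtain ⟨t₀, ht₀, x₀, heq, hle, hstrict, -, hineq⟩ :=
    s.exists_firstOvershoot_ceiling one_pos hQ (le_trans one_le_two hk) hT'.1 hcl
      (fun t ht => (hagree t ht).1) henergy ⟨t, ht, x, le_of_not_ge hgt⟩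
  have hpos := h S hP hR hQ k hk s T' hT' u p hcl hagree henergy t₀ ht₀ x₀ heq hle hstrict
  rw [one_mul] at hineq
  exact absurd hineq (not_le.2 hpos)

end Summit.NavierStokesRegularity.FluidComputer.PalasekTowerClayBridge

end
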